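import Mathlib.Topology.Instances.Real.Lemmas
import Mathlib.Data.Nat.Log
import Literature.Computability.Complexity.Classes
import Literature.Computability.Complexity.Nondeterministic
import Literature.Computability.Complexity.Space
import HarnessLib

-- provenance: harness21/H21/H21/Statements/PNP/TimeSpace.lean @ dad3d28 (interim HEAD d8f2665); M5 mechanical rewrite
/-!
# P vs NP family: hierarchy and time–space theorems

Family `PNP` (trunk `CplxCore`), statements **pnp.S13**, **pnp.S14**, **pnp.S37**:

* the deterministic time hierarchy theorem of Hartmanis–Stearns (1965, Thm 9 / Cor 9.1):
  `T(n)² / U(n) → 0` for time-constructible `T`, `U` implies `DTIME T ⊂ DTIME U`;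
* the standard chain `LOGSPACE ⊆ P ⊆ NP ⊆ PSPACE` together with `LOGSPACE ⊂ PSPACE`
  (Cook, Clay problem description §3; Stearns–Hartmanis–Lewis 1965, space hierarchy);
* Williams' simulation `TIME[t] ⊆ SPACE[√(t log t)]` (STOC 2025, Thm 1.1).

All classes (`DTIME`, `P`, `NP`, `DSPACE`, `LOGSPACE`, `PSPACE`, `IsTimeConstructible`) come
from the accepted prelude modules `Literature.Prelude.CplxCore.Classes`, `.Nondeterministic`, `.Space`
(sets of `Language Bool`, arithmetic big-O closure `c * t n + c`). Mathlib has no complexity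
classes (searched `DTIME`, `DSPACE`, `PSPACE`, `hierarchy` in `Mathlib/Computability`: nothing
beyond `Turing.TM2ComputableInPolyTime`); we reuse `Filter.Tendsto`, `Filter.atTop`, `nhds`,
`Nat.sqrt`, `Nat.log`.

## Design notes

* Hartmanis–Stearns state Thm 9 for *real-time countable* `T` and `U` with hypothesis
  `inf_n T(n)² / U(n) = 0`; real-time countability implies time-constructibility
  (`IsTimeConstructible`, Sipser's form), and the inventory text's limit form
  `T(n)² / U(n) → 0` (which implies the `inf` form and also gives `DTIME T ⊆ DTIME U`) is used,
  phrased with `Filter.Tendsto ... atTop (𝓝 0)` over `ℝ` (division by `U n = 0` is harmless: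
  `IsTimeConstructible U` forces `n ≤ U n`).
* Multitape Turing machines (Williams' model) and Mathlib's multi-stack `TM2` machines with the
  read-only two-stack input of `Literature.Computability.Complexity.SpaceMachine` simulate each other with constant
  factor overhead in space and polynomial (indeed linear, tape-by-two-stacks) overhead in time,
  so the classes `DTIME`, `DSPACE` below agree with the textbook ones up to the constants
  absorbed by their big-O definitions.

## References

* J. Hartmanis, R. E. Stearns, *On the computational complexity of algorithms*, Trans. AMS 117
  (1965), Thm 9 and Cor 9.1.
* R. E. Stearns, J. Hartmanis, P. M. Lewis II, *Hierarchies of memory limited computations*,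
  FOCS/SWCT 1965.
* S. Cook, *The P versus NP problem*, Clay Mathematics Institute problem description (2000), §3.
* R. Williams, *Simulating Time With Square-Root Space*, Proc. 57th STOC (2025) 13–23, Thm 1.1
  (doi:10.1145/3717823.3718225; arXiv:2502.17779; J. ACM 2026, doi:10.1145/3798104). [Williams2025]
* S. Arora, B. Barak, *Computational Complexity: A Modern Approach*, CUP 2009, Thm 3.1, Thm 4.2,
  Thm 4.8.
-/

namespace Literature.Computability.Complexity

open Filter Topology

/-! ### Time hierarchy -/

/-- **pnp.S13** (deterministic time hierarchy theorem; Hartmanis–Stearns 1965, Thm 9 /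
Cor 9.1). If `T` and `U` are time-constructible and `T(n)² / U(n) → 0` as `n → ∞`, then
`DTIME T ⊂ DTIME U` (strict inclusion). Hartmanis–Stearns assume both `T` and `U` real-time
countable (which implies `IsTimeConstructible`) and the weaker hypothesis
`inf_n T(n)² / U(n) = 0`, concluding that `DTIME U \ DTIME T` is nonempty; the limit form used
here (the inventory text) additionally yields `DTIME T ⊆ DTIME U`, whence Cor 9.1's strict
inclusion. (Hennie–Stearns 1966 improve `T²` to `T log T`; Arora–Barak 2009, Thm 3.1.) [cite: HartmanisStearns1965, Thm 9 / Cor 9.1] -/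
def time_hierarchy : Prop :=
  ∀ (T U : ℕ → ℕ) (hT : IsTimeConstructible T) (hU : IsTimeConstructible U) (h : Tendsto (fun n => (T n : ℝ) ^ 2 / U n) atTop (𝓝 0)),
    DTIME T ⊂ DTIME U

/-! ### The basic chain of inclusions -/

/-- `LOGSPACE ⊆ P`: a log-space machine has polynomially many configurations, hence runs in
polynomial time (simulation of an input-preserving `SpaceMachine` by a `TM2` time decider).
[Cook, Clay §3; Arora–Barak 2009, Thm 4.2 (SPACE(s) ⊆ DTIME(2^{O(s)}))] [cite: AroraBarak2009, Thm 4.2 (SPACE(s] -/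
def LOGSPACE_subset_P : Prop :=
  LOGSPACE ⊆ Classes.P

/-- **pnp.S14** (first part; Cook, Clay problem description §3). The chain of inclusions
`LOGSPACE ⊆ P ⊆ NP ⊆ PSPACE`. [Cook, Clay §3; Arora–Barak 2009, Thm 4.2 and §4.1; Sipser,
Thm 8.5 ff.] [cite: AroraBarak2009, Thm 4.2 and §4.1] -/
def logspace_subset_P_subset_NP_subset_PSPACE : Prop :=
  LOGSPACE ⊆ Classes.P ∧ Classes.P ⊆ Nondeterministic.NP ∧ Nondeterministic.NP ⊆ PSPACE

/- interim proof relied on results that are now named facts (D-0014); demoted to a fact by the M5 import, proof preserved: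
:=
  ⟨LOGSPACE_subset_P, P_subset_NP, NP_subset_PSPACE⟩
-/

/-- **pnp.S14** (second part; space hierarchy theorem, Stearns–Hartmanis–Lewis 1965).
`LOGSPACE ⊂ PSPACE` (strict inclusion), so at least one inclusion of the chain
`LOGSPACE ⊆ P ⊆ NP ⊆ PSPACE` is strict. [Stearns–Hartmanis–Lewis 1965; Cook, Clay §3;
Arora–Barak 2009, Thm 4.8; Sipser, Cor. 9.4 ff.] [cite: StearnsHartmanisLewis1965] -/
def LOGSPACE_ssubset_PSPACE : Prop :=
  LOGSPACE ⊂ PSPACE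

/-! ### Williams' square-root-space simulation -/

/-- **pnp.S37** (Williams, STOC 2025, Thm 1.1; arXiv:2502.17779). For every `t` with
`t n ≥ n`, `TIME[t] ⊆ SPACE[√(t log t)]`: every language decidable in deterministic time
`O(t n)` is decidable in space `O(√(t n · log t n))`, stated with `Nat.sqrt` and `Nat.log 2`
(each within a factor `2` of `√`, `log₂` once `t n ≥ 2`, absorbed by the constant of `DSPACE`).
As printed: "For every function `t(n) ≥ n`, `TIME[t(n)] ⊆ SPACE[√(t(n) log t(n))]`", where
`TIME[t]` (`SPACE[s]`) is the class decided by `O(t(n))`-time (`O(s(n))`-space) multitape Turing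
machines; no constructibility of `t` is assumed (§3, opening remark: the simulation tries
`t(n) = n, n + 1, …`), and space below the input length is in the read-only-input model (§3.2:
the leaves `content(1,0,i)` are `b(n)`-length slices of the input). Mathlib's multi-stack `TM2`
machines (for `DTIME`: a `k`-stack machine is a `k`-tape machine whose heads sit at the stack
tops) and the read-only-input space machines of `DSPACE` (a tape is two stacks; the input head
is the pair `kL`/`k₀`) are equivalent to multitape machines up to the constant factors absorbed
by the big-O closures in `DTIME`/`DSPACE`. Proof architecture (Williams 2025, §3.2):
Hopcroft–Paul–Valiant block-respecting form (Lemma 2.1), an `O(t/b)`-bit enumeration of the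
head-movement pattern determining the computation graph (Claims 3.4–3.5), implicit Tree
Evaluation instances of height `O(t/b)`, fan-in `2p`, bit-length `O(b)` solved by the Cook–Mertz
procedure in space `O(b + (t/b) log b)` (Thm 2.2 = Cook–Mertz 2024, Thm 7), `b = √(t log t)`.
[Williams 2025, Thm 1.1; improves Hopcroft–Paul–Valiant 1977, `TIME[t] ⊆ SPACE[t / log t]`]
[cite: Williams2025, Thm 1.1] -/
def DTIME_subset_DSPACE_sqrt : Prop :=
  ∀ (t : ℕ → ℕ) (ht : ∀ n, n ≤ t n),
    DTIME t ⊆ DSPACE (fun n => Nat.sqrt (t n * Nat.log 2 (t n)))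

end Literature.Computability.Complexity
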